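import Summits.AnomalousDissipation.AnomalousDissipation.Theses.MomentParity
import Literature.Analysis.FluidPDE.StatisticalSolutionProofs
import Literature.Analysis.FluidPDE.StatisticalSolutionEnergyEq
import Literature.Analysis.FluidPDE.StatisticalSolutionDirac
import Literature.Analysis.FluidPDE.CylindricalGenerator
import Literature.Analysis.FunctionSpaces.TorusSpectralWeakDerivative
import Literature.Analysis.FunctionSpaces.TorusFourierModes
import Literature.Analysis.FunctionSpaces.TorusFourierCalculus

/-!
# Negative knowledge for the crux `MomentParity.QuarticGate` (stmt-AnomalousDissipation-11464):
# load-bearing analysis I — vocabulary, level ceiling, loudness floor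

Certified copy of sections Vocabulary/A/B of the cdisprove work file `Cruxes/QuarticGate/Disproof.lean`
(refuter-cdisprove-stmt-AnomalousDissipation-11464-0, cycle 1). Supports stmt-AnomalousDissipation-11464; no
positive route-item statement is asserted (the crux is an `∃`-statement; what is proved here are necessary
conditions on its witnesses, refutations of natural strengthenings, and one trivial weakening).

* `quarticGate_iff` — the crux ↔ its clauses named (`IsLevel`, `IsBandTest`, `polyGrad`, `IsPolyStationary`,
  `IsQuarticWitness`), by `Iff.rfl`.
* (A) `eGradNormSq_le_of_level` (Bernstein `‖∇v‖² ≤ 4π²N²‖v‖²` on the ball), `ensembleDissipation_le_of_level`,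
  `IsQuarticWitness.eps_le` (`ε ≤ 4π²N²νE`), `not_quarticGateBoundedLevel` — the strengthening with the level `N`
  chosen before `j` is FALSE: witnesses live at `N ≳ ν_j^{-1/2}`.
* (B) `quarticGateWithoutEpsPos_holds` — without `0 < ε` the statement is trivial (`δ₀`, `f = 0`).
* (C) the energy row and the force floor are in the sibling file `Negative/EnergyRow.lean`.
-/

namespace Summit.AnomalousDissipation.AnomalousDissipation.Theorems.QuarticGate.Negative

open MeasureTheory Filter Topology
open scoped ENNReal InnerProductSpace RealInnerProductSpace
open Literature.Analysis.FunctionSpaces Literature.Analysis.FluidPDE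
open Summit.AnomalousDissipation.AnomalousDissipation.Theses.MomentParity


noncomputable section

/-! ## Vocabulary (verbatim clauses of `QuarticGate`, named) -/

/-- Level-`N` carried field: `û(k) = 0` off `0 < |k|² ≤ N²` (verbatim clause of `QuarticGate`). -/
def IsLevel (N : ℕ) (u : Torus.energySpace (Fin 3)) : Prop :=
  ∀ k ∉ (Torus.freqBall N).erase (0 : Fin 3 → ℤ),
    UnitAddTorus.mFourierCoeff (EuclideanSpace.complexify ∘
      (u.1 : UnitAddTorus (Fin 3) → EuclideanSpace ℝ (Fin 3))) k = 0

/-- Band-limited smooth solenoidal mean-zero test field (verbatim clause of `QuarticGate`). -/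
def IsBandTest (N : ℕ) (g : UnitAddTorus (Fin 3) → EuclideanSpace ℝ (Fin 3)) : Prop :=
  Torus.IsSmooth g ∧ Torus.IsDivFree g ∧ Torus.HasZeroMean g ∧
    ∀ k ∉ (Torus.freqBall N).erase (0 : Fin 3 → ℤ),
      UnitAddTorus.mFourierCoeff (EuclideanSpace.complexify ∘ g) k = 0

/-- `∇p(u) = Σᵢ ∂ᵢP((u,g₁),…,(u,gₘ)) gᵢ` (verbatim test-field expression of `QuarticGate`). -/
def polyGrad {m : ℕ} (g : Fin m → UnitAddTorus (Fin 3) → EuclideanSpace ℝ (Fin 3))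
    (P : MvPolynomial (Fin m) ℝ) (u : Torus.energySpace (Fin 3)) :
    UnitAddTorus (Fin 3) → EuclideanSpace ℝ (Fin 3) :=
  fun x => ∑ i : Fin m,
    (MvPolynomial.eval (fun j => Torus.pairing u.1 (g j)) (MvPolynomial.pderiv i P)) • g i x

/-- `d`-stationarity of `μ` for Galerkin NS at `(ν, f)` and level `N`: every polynomial cylindrical
observable of total degree `≤ d − 1` with level-`N` band tests is drift-free (row integrable and `0`). -/
def IsPolyStationary (ν : ℝ) (f : UnitAddTorus (Fin 3) → EuclideanSpace ℝ (Fin 3)) (N d : ℕ)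
    (μ : Measure (Torus.energySpace (Fin 3))) : Prop :=
  ∀ (m : ℕ) (g : Fin m → UnitAddTorus (Fin 3) → EuclideanSpace ℝ (Fin 3))
    (P : MvPolynomial (Fin m) ℝ), (∀ i, IsBandTest N (g i)) → P.totalDegree + 1 ≤ d →
    Integrable (fun u => Torus.nsGeneratorPairing ν f u (polyGrad g P u)) μ ∧
      ∫ u, Torus.nsGeneratorPairing ν f u (polyGrad g P u) ∂μ = 0

/-- The level-`N` witness clauses of `QuarticGate` at viscosity `ν` with budgets `E`, `ε`. -/
def IsQuarticWitness (f : UnitAddTorus (Fin 3) → EuclideanSpace ℝ (Fin 3)) (ν : ℝ) (N : ℕ)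
    (E ε : ℝ) (μ : Measure (Torus.energySpace (Fin 3))) : Prop :=
  IsProbabilityMeasure μ ∧ (∀ᵐ u ∂μ, IsLevel N u) ∧
    Integrable (fun u : Torus.energySpace (Fin 3) => ‖u‖ ^ 4) μ ∧
    IsPolyStationary ν f N 4 μ ∧ Torus.ensembleEnergy μ ≤ E ∧ ε ≤ Torus.ensembleDissipation ν μ

/-- `QuarticGate` restated through the vocabulary (definitional unfolding, `Iff.rfl`). -/
theorem quarticGate_iff :
    QuarticGate ↔ ∃ f : UnitAddTorus (Fin 3) → EuclideanSpace ℝ (Fin 3),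
      Torus.IsSmooth f ∧ Torus.IsDivFree f ∧ Torus.HasZeroMean f ∧
      ∃ (ν : ℕ → ℝ) (E ε : ℝ), (∀ j, 0 < ν j) ∧ Tendsto ν atTop (𝓝 0) ∧ 0 < ε ∧
      ∀ j : ℕ, ∃ᶠ N in atTop, ∃ μ, IsQuarticWitness f (ν j) N E ε μ :=
  Iff.rfl


/-! ## A. The level-`N` dissipation ceiling (Bernstein) — loud witnesses need `N ≳ ν^{-1/2}` -/

section Ceiling

variable {d : Type*} [Fintype d] [DecidableEq d]

/-- **Bernstein inequality, spectral form.** An `L²` field carried by the frequencies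
`0 < |k|² ≤ N²` has `‖∇v‖₂² ≤ 4π²N² ‖v‖₂²` (in `ℝ≥0∞`). [folklore] -/
theorem eGradNormSq_le_of_level {N : ℕ}
    (v : Lp (EuclideanSpace ℝ d) 2 (volume : Measure (UnitAddTorus d)))
    (hv : ∀ k ∉ (Torus.freqBall N).erase (0 : d → ℤ),
      UnitAddTorus.mFourierCoeff (EuclideanSpace.complexify ∘
        (v : UnitAddTorus d → EuclideanSpace ℝ d)) k = 0) :
    Torus.eGradNormSq (v : UnitAddTorus d → EuclideanSpace ℝ d) ≤
      ENNReal.ofReal (4 * Real.pi ^ 2 * (N : ℝ) ^ 2) * ‖v‖ₑ ^ 2 := by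
  rw [Torus.eGradNormSq_eq_tsum, Torus.enorm_sq_coe_eq_tsum, ← ENNReal.tsum_mul_left,
    ← ENNReal.tsum_mul_left]
  refine ENNReal.tsum_le_tsum fun k => ?_
  by_cases hk : k ∈ (Torus.freqBall N).erase (0 : d → ℤ)
  · have hkN : Torus.freqNormSq k ≤ (N : ℝ) ^ 2 := Torus.mem_freqBall.1 (Finset.mem_of_mem_erase hk)
    rw [← mul_assoc, ← ENNReal.ofReal_mul (by positivity)]
    gcongr
  · rw [hv k hk]
    simp

/-- **Level ceiling for the mean enstrophy**: a measure carried by level-`N` fields has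
`∫ ‖∇u‖² dμ ≤ 4π²N² ∫ |u|² dμ` (in `ℝ≥0∞`). [folklore] -/
theorem ensembleEnstrophy_le_of_level {N : ℕ} {μ : Measure (Torus.energySpace d)}
    (hlev : ∀ᵐ u : Torus.energySpace d ∂μ, ∀ k ∉ (Torus.freqBall N).erase (0 : d → ℤ),
      UnitAddTorus.mFourierCoeff (EuclideanSpace.complexify ∘
        (u.1 : UnitAddTorus d → EuclideanSpace ℝ d)) k = 0) :
    Torus.ensembleEnstrophy μ ≤
      ENNReal.ofReal (4 * Real.pi ^ 2 * (N : ℝ) ^ 2) * ∫⁻ u, ‖u‖ₑ ^ 2 ∂μ := by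
  rw [Torus.ensembleEnstrophy, ← lintegral_const_mul' _ _ ENNReal.ofReal_ne_top]
  exact lintegral_mono_ae (hlev.mono fun u hu => eGradNormSq_le_of_level _ hu)

/-- **Level ceiling for the dissipation**: a finite measure carried by level-`N` fields with
finite mean energy has `ν ∫‖∇u‖² dμ ≤ 4π²N² ν ∫|u|² dμ`, i.e.
`ensembleDissipation ν μ ≤ 4π² N² ν · ensembleEnergy μ` (`0 ≤ ν`). Bounded level-`N` ensembles are
quiet as `ν → 0`: the `∃ᶠ N` of `QuarticGate` must escape to infinity at least like
`N ≥ (ε / (4π² ν_j E))^{1/2}` (cf. the route header's NUMBERS line). [folklore] -/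
theorem ensembleDissipation_le_of_level {ν : ℝ} (hν : 0 ≤ ν) {N : ℕ}
    {μ : Measure (Torus.energySpace d)}
    (hlev : ∀ᵐ u : Torus.energySpace d ∂μ, ∀ k ∉ (Torus.freqBall N).erase (0 : d → ℤ),
      UnitAddTorus.mFourierCoeff (EuclideanSpace.complexify ∘
        (u.1 : UnitAddTorus d → EuclideanSpace ℝ d)) k = 0)
    (hE : Integrable (fun u : Torus.energySpace d => ‖u‖ ^ 2) μ) :
    Torus.ensembleDissipation ν μ ≤ 4 * Real.pi ^ 2 * (N : ℝ) ^ 2 * ν * Torus.ensembleEnergy μ := by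
  have h1 := ensembleEnstrophy_le_of_level hlev
  have h2 : ∫⁻ u, ‖u‖ₑ ^ 2 ∂μ = ENNReal.ofReal (Torus.ensembleEnergy μ) := by
    rw [Torus.ensembleEnergy, ofReal_integral_eq_lintegral_ofReal hE
      (ae_of_all _ fun u => by positivity)]
    refine lintegral_congr fun u => ?_
    rw [← ofReal_norm, ← ENNReal.ofReal_pow (norm_nonneg _)]
  rw [h2, ← ENNReal.ofReal_mul (by positivity)] at h1
  have hE0 : 0 ≤ Torus.ensembleEnergy μ := integral_nonneg fun u => by positivity
  have h3 : (Torus.ensembleEnstrophy μ).toReal ≤ 4 * Real.pi ^ 2 * (N : ℝ) ^ 2 * Torus.ensembleEnergy μ := by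
    have := ENNReal.toReal_mono ENNReal.ofReal_ne_top h1
    rwa [ENNReal.toReal_ofReal (by positivity)] at this
  unfold Torus.ensembleDissipation
  calc ν * (Torus.ensembleEnstrophy μ).toReal
      ≤ ν * (4 * Real.pi ^ 2 * (N : ℝ) ^ 2 * Torus.ensembleEnergy μ) :=
        mul_le_mul_of_nonneg_left h3 hν
    _ = 4 * Real.pi ^ 2 * (N : ℝ) ^ 2 * ν * Torus.ensembleEnergy μ := by ring

end Ceiling

/-- On a finite measure, `‖u‖⁴` integrable ⇒ `‖u‖²` integrable. [folklore] -/
theorem integrable_norm_sq_of_norm_pow_four {μ : Measure (Torus.energySpace (Fin 3))}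
    [IsFiniteMeasure μ] (h4 : Integrable (fun u : Torus.energySpace (Fin 3) => ‖u‖ ^ 4) μ) :
    Integrable (fun u : Torus.energySpace (Fin 3) => ‖u‖ ^ 2) μ := by
  refine Integrable.mono' ((integrable_const (1 : ℝ)).add h4)
    (continuous_norm.pow 2).aestronglyMeasurable (ae_of_all _ fun u => ?_)
  simp only [Pi.add_apply, Real.norm_eq_abs, abs_of_nonneg (by positivity : (0 : ℝ) ≤ ‖u‖ ^ 2)]
  nlinarith [sq_nonneg (‖u‖ ^ 2 - 1), sq_nonneg ‖u‖]

/-- **Quantitative ceiling for witnesses**: a level-`N` witness of `QuarticGate` at viscosity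
`ν ≥ 0` obeys `ε ≤ 4π² N² ν E` (only the level clause, the fourth-moment clause and the two
budget clauses are used — stationarity is NOT used). [folklore] -/
theorem IsQuarticWitness.eps_le {f : UnitAddTorus (Fin 3) → EuclideanSpace ℝ (Fin 3)} {ν : ℝ}
    (hν : 0 ≤ ν) {N : ℕ} {E ε : ℝ} {μ : Measure (Torus.energySpace (Fin 3))}
    (h : IsQuarticWitness f ν N E ε μ) : ε ≤ 4 * Real.pi ^ 2 * (N : ℝ) ^ 2 * ν * E := by
  obtain ⟨hprob, hlev, h4, -, hEn, hε⟩ := h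
  have hdiss := ensembleDissipation_le_of_level hν hlev (integrable_norm_sq_of_norm_pow_four h4)
  have hE0 : 0 ≤ Torus.ensembleEnergy μ := integral_nonneg fun u => by positivity
  calc ε ≤ Torus.ensembleDissipation ν μ := hε
    _ ≤ 4 * Real.pi ^ 2 * (N : ℝ) ^ 2 * ν * Torus.ensembleEnergy μ := hdiss
    _ ≤ 4 * Real.pi ^ 2 * (N : ℝ) ^ 2 * ν * E := by gcongr

/-- At a FIXED level `N`, witnesses exist for only finitely many `j` along any `ν_j → 0`. -/
theorem eventually_not_isQuarticWitness (f : UnitAddTorus (Fin 3) → EuclideanSpace ℝ (Fin 3))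
    {ν : ℕ → ℝ} (hν : ∀ j, 0 < ν j) (hν0 : Tendsto ν atTop (𝓝 0)) (E : ℝ) {ε : ℝ} (hε : 0 < ε)
    (N : ℕ) : ∀ᶠ j in atTop, ∀ μ, ¬ IsQuarticWitness f (ν j) N E ε μ := by
  set C : ℝ := 4 * Real.pi ^ 2 * (N : ℝ) ^ 2 * max E 0 + 1 with hC
  have hCpos : 0 < C := by positivity
  have hev : ∀ᶠ j in atTop, ν j < ε / C :=
    (tendsto_order.1 hν0).2 _ (div_pos hε hCpos)
  refine hev.mono fun j hj μ hw => ?_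
  have h1 := hw.eps_le (hν j).le
  have h2 : 4 * Real.pi ^ 2 * (N : ℝ) ^ 2 * ν j * E ≤ ν j * (C - 1) := by
    have : 4 * Real.pi ^ 2 * (N : ℝ) ^ 2 * ν j * E ≤ 4 * Real.pi ^ 2 * (N : ℝ) ^ 2 * ν j * max E 0 := by
      gcongr
      · exact mul_nonneg (by positivity) (hν j).le
      · exact le_max_left _ _
    rw [hC]; nlinarith [this]
  have h3 : ν j * (C - 1) < ε := by
    have := (lt_div_iff₀ hCpos).1 hj
    nlinarith [(hν j).le]
  linarith

/-- NATURAL STRENGTHENING 1 (refuted): `QuarticGate` with the Galerkin level `N` chosen BEFORE the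
viscosity index `j` (even only frequently in `j`). -/
def QuarticGateBoundedLevel : Prop :=
  ∃ f : UnitAddTorus (Fin 3) → EuclideanSpace ℝ (Fin 3),
    Torus.IsSmooth f ∧ Torus.IsDivFree f ∧ Torus.HasZeroMean f ∧
    ∃ (ν : ℕ → ℝ) (E ε : ℝ), (∀ j, 0 < ν j) ∧ Tendsto ν atTop (𝓝 0) ∧ 0 < ε ∧
    ∃ N : ℕ, ∃ᶠ j in atTop, ∃ μ, IsQuarticWitness f (ν j) N E ε μ

/-- **`¬ QuarticGateBoundedLevel`**: no level can be uniform in `j` — the dissipation of a level-`N`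
ensemble of energy `≤ E` is `≤ 4π²N²ν_jE → 0`. So every proof of `QuarticGate` must let its levels
`N` escape to infinity (at least like `ν_j^{-1/2}`); every construction at `N ≍ ν_j^{-1/2}` serves
finitely many `j` per level (this is the Taylor-window confinement that killed line
`gibbs-sea-pushforward`, in its crudest form). [folklore] -/
theorem not_quarticGateBoundedLevel : ¬ QuarticGateBoundedLevel := by
  rintro ⟨f, -, -, -, ν, E, ε, hν, hν0, hε, N, hfreq⟩
  obtain ⟨j, ⟨μ, hμ⟩, hno⟩ :=
    (hfreq.and_eventually (eventually_not_isQuarticWitness f hν hν0 E hε N)).exists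
  exact hno μ hμ


/-! ## B. Load-bearing clauses: weakenings of `QuarticGate` that hold trivially -/

section LoadBearing

/-- Fourier coefficients of the representative of `0 ∈ L²` vanish. [folklore] -/
theorem mFourierCoeff_coe_zero (k : Fin 3 → ℤ) :
    UnitAddTorus.mFourierCoeff (EuclideanSpace.complexify ∘
      (((0 : Torus.energySpace (Fin 3)).1 :
        Lp (EuclideanSpace ℝ (Fin 3)) 2 (volume : Measure (UnitAddTorus (Fin 3)))) :
          UnitAddTorus (Fin 3) → EuclideanSpace ℝ (Fin 3))) k = 0 := by
  rw [Torus.mFourierCoeff_eq_integral_volume]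
  have h0 := Lp.coeFn_zero (EuclideanSpace ℝ (Fin 3)) 2 (volume : Measure (UnitAddTorus (Fin 3)))
  rw [integral_congr_ae (g := fun _ => (0 : EuclideanSpace ℂ (Fin 3))) (h0.mono fun x hx => by
    simp only [Submodule.coe_zero, Function.comp_apply]
    rw [hx]; simp)]
  simp

/-- The generator row vanishes at `u = 0` when `f = 0`: `⟨F(0), w⟩ = 0`. [folklore] -/
theorem nsGeneratorPairing_zero_zero (ν : ℝ) (w : UnitAddTorus (Fin 3) → EuclideanSpace ℝ (Fin 3)) :
    Torus.nsGeneratorPairing ν (fun _ => 0) (0 : Torus.energySpace (Fin 3)) w = 0 := by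
  unfold Torus.nsGeneratorPairing Torus.inertialPairing
  simp

/-- The Dirac mass at `0 ∈ H` is a (trivially loud-free) witness at every level for `f = 0`,
`E = 0`, `ε = 0`: all rows vanish identically. [folklore] -/
theorem isQuarticWitness_dirac_zero (ν : ℝ) (hν : 0 ≤ ν) (N : ℕ) :
    IsQuarticWitness (fun _ => 0) ν N 0 0 (Measure.dirac (0 : Torus.energySpace (Fin 3))) := by
  haveI : MeasurableSingletonClass (Torus.energySpace (Fin 3)) :=
    OpensMeasurableSpace.toMeasurableSingletonClass
  refine ⟨inferInstance, ?_, Torus.integrable_dirac _ _, ?_, ?_, ?_⟩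
  · rw [ae_dirac_eq]
    simp only [eventually_pure]
    intro k _
    exact mFourierCoeff_coe_zero k
  · intro m g P _ _
    refine ⟨Torus.integrable_dirac _ _, ?_⟩
    rw [integral_dirac]
    exact nsGeneratorPairing_zero_zero ν _
  · simp [Torus.ensembleEnergy, integral_dirac]
  · exact mul_nonneg hν ENNReal.toReal_nonneg

/-- WEAKENING 1 (holds trivially): `QuarticGate` without `0 < ε`. -/
def QuarticGateWithoutEpsPos : Prop :=
  ∃ f : UnitAddTorus (Fin 3) → EuclideanSpace ℝ (Fin 3),
    Torus.IsSmooth f ∧ Torus.IsDivFree f ∧ Torus.HasZeroMean f ∧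
    ∃ (ν : ℕ → ℝ) (E ε : ℝ), (∀ j, 0 < ν j) ∧ Tendsto ν atTop (𝓝 0) ∧
    ∀ j : ℕ, ∃ᶠ N in atTop, ∃ μ, IsQuarticWitness f (ν j) N E ε μ

/-- **`0 < ε` is load-bearing**: without it `δ₀` with `f = 0` witnesses everything
(`ν_j = 1/(j+1)`, `E = ε = 0`). Any proof of `QuarticGate` lives entirely in the loudness floor. -/
theorem quarticGateWithoutEpsPos_holds : QuarticGateWithoutEpsPos := by
  have hzero : (Torus.realTrigPoly (∅ : Finset (Fin 3 → ℤ)) (0 : (Fin 3 → ℤ) → EuclideanSpace ℂ (Fin 3)))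
      = fun _ => 0 := Torus.realTrigPoly_zero ∅
  refine ⟨fun _ => 0, Torus.isSmooth_const _, ?_, ?_, fun j => 1 / ((j : ℝ) + 1), 0, 0,
    fun j => by positivity, tendsto_one_div_add_atTop_nhds_zero_nat, fun j => ?_⟩
  · rw [← hzero]
    exact Torus.isDivFree_realTrigPoly fun k hk => by simp at hk
  · simp [Torus.HasZeroMean]
  · exact Frequently.of_forall fun N => ⟨_, isQuarticWitness_dirac_zero _ (by positivity) N⟩

end LoadBearing

end

end Summit.AnomalousDissipation.AnomalousDissipation.Theorems.QuarticGate.Negative
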